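import Summits.KontsevichZagierPeriods.Zeta5Search.Barrier.ConeGammaCuspPeriodCountGauge

/-!
# ζ(5) search — BARRIER: THE SAVING AS A FUNCTION OF THE 28 FLOORS, and THE CANONICAL JUNCTION PATTERN FUNCTION

HONEST FRAMING (cell `pub-zeta5`): systematic search; no irrationality claim unless kernel-certified. MODEL objects
under Brown–Zudilin's (28)+(30) accounting ([BZ22] = arXiv:2210.03391; (28) observed, not proved); nothing here is a
statement about `ζ(5)`, any `γ` of record, the cone's supremum (C2 OPEN) or the value of the saving, of a pattern
function or of the cusp slope at a named direction (DATA of the cell); S-E stays CONJECTURED; records in print UNMOVED.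
Prover P2 g33, item «THE CANONICAL PATTERN FUNCTION» (P2 g32's successor menu (a): discharge the unit-marginal-spread
hypothesis `hspread` STRUCTURALLY), file (1) of 3 — the one DEFINITION file of the item.

THE POINT. P2 g30–g32 carry the junction pattern functions `f m` (and the period pattern function `F(A) = Σ f m (A ∩ M m)`)
as HYPOTHESES: `hf` pins `f m` on the REALISABLE member-sign patterns only (those of some displacement `Δ ∈ ℝ⁸`); on the
other («virtual») patterns `f m` is a free extension, and the structural hypotheses of the chain (`hsub`, `hsuper`, `hdef`,
`hspread`) speak about that extension. This file makes the extension CANONICAL and explicit, with no choice left: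
* `pairVal N i j` — a 28-vector read on the unordered pair `{i,j}`; `floorTerm N σ = Σ_{i∈F} (N_i − N_{π_σ i})` and
  **`floorN N = max_σ floorTerm N σ`** — Brown–Zudilin's torus saving READ ON AN ARBITRARY INTEGER VECTOR `N ∈ ℤ²⁸` in place
  of the 28 floors; **`torusN_eq_floorN`**: `𝒩(θ) = floorN (⌊φ_k θ⌋)_k` (the saving depends on `θ` only through its 28 floors —
  `torusN_congr_floor` made a formula); `sum_univ_pair_liftPerm` (the `S₇`-invariance of symmetric pair statistics on
  28-vectors), `floorN_nonneg`;
* **`patternN a b A = floorN (⌊b·h_k(a)⌋ − [b·h_k(a) ∈ ℤ ∧ k ∉ A])_k`** — THE CANONICAL JUNCTION PATTERN FUNCTION at height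
  `b` on ALL subsets `A` of the 28 forms: the member floors set «up» on `A` and «down» off `A`, the non-member floors frozen
  (the cell's Hamiltonian-path extension — P2 g11's `germ_costs` — in floor form);
* **`torusN_bkpt_add_eq_patternN`** — at a junction `b ∈ bkpts a T`, for every displacement `Δ` below the walls,
  `𝒩(θ_b + Δ) = patternN a b {k ∈ M : 0 ≤ φ_k(Δ)}` for ANY finset `M` containing the members: the hypothesis `hf` of the
  whole cusp chain (`germ_pair_eq_lovasz`, `cuspSlope_eq_lovasz_period`, …) is DISCHARGED by `f := patternN a b`;
  `patternN_congr` — only the member part of the pattern matters.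
File (2) `ConeGammaCuspPatternOriented` proves the oriented unit marginals of `patternN` on EVERY pattern (so `hspread` is a
theorem), file (3) `ConeGammaCuspPeriodCanonical` draws the hypothesis-free junction-count gauge and cone certificate.
DESK (DATA, `HOME/pub-zeta5-p2/g33/alg/canon.py`, exact, brute force over the 5040 permutations, independent of P2 g11's
Held–Karp): `floorN ∘ floors =` P2 g11's `𝒩` on 300 random rational `θ` (0 failures); `patternN =` the desk's virtual
extension used by P2 g30–g32's censuses on 950 random and 950 genuinely virtual (dependent-member) junction patterns at
record/41, flag/60, argmax-120, t*/480 (0 failures). NOT here: any value of `patternN` at a named junction; `γ`, C2, S-E, `ζ(5)`.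
-/

noncomputable section

open Set MeasureTheory Finset
open scoped Topology

namespace Summit.KontsevichZagierPeriods.Zeta5Search.Barrier.ConeGamma

/-! ### A 28-vector read on unordered pairs; `S₇`-invariance of symmetric pair statistics -/

/-- The entry of a 28-vector `N` at the unordered pair `{i, j}` of `Fin 8`, through the table `idxOf` (smaller index
first; on the diagonal an unused filler). -/
def pairVal {α : Type*} (N : Fin 28 → α) (i j : Fin 8) : α :=
  if i < j then N (idxOf i j) else N (idxOf j i)

/-- `pairVal` is symmetric. -/
theorem pairVal_comm {α : Type*} (N : Fin 28 → α) (i j : Fin 8) : pairVal N i j = pairVal N j i := by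
  unfold pairVal
  rcases lt_trichotomy i j with h | rfl | h
  · rw [if_pos h, if_neg (not_lt.mpr h.le)]
  · rfl
  · rw [if_neg (not_lt.mpr h.le), if_pos h]

/-- Reading `N` on the pair of form `k` gives back `N k`. -/
theorem pairVal_fstIdx_sndIdx {α : Type*} (N : Fin 28 → α) (k : Fin 28) :
    pairVal N (fstIdx k) (sndIdx k) = N k := by
  unfold pairVal
  rw [if_pos (fstIdx_lt_sndIdx k), idxOf_fstIdx_sndIdx]

/-- Reading a statistic of the 28 forms of `θ` on a pair `i ≠ j` gives the statistic of the pair form. -/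
theorem pairVal_phiForm {α : Type*} (g : ℝ → α) (θ : Fin 8 → ℝ) {i j : Fin 8} (hij : i ≠ j) :
    pairVal (fun k => g (phiForm θ k)) i j = g (pairForm θ i j) := by
  unfold pairVal
  rcases lt_or_gt_of_ne hij with h | h
  · rw [if_pos h, pairForm_eq_phiForm_idxOf θ h]
  · rw [if_neg (not_lt.mpr h.le), pairForm_comm, pairForm_eq_phiForm_idxOf θ h]

/-- **`S₇` permutes the 28 pairs**: for a SYMMETRIC integer pair statistic `G`,
`Σ_k G(σ̃ (fstIdx k), σ̃ (sndIdx k)) = Σ_k G(fstIdx k, sndIdx k)` (`σ̃ = liftPerm σ` fixes `0`). -/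
theorem sum_univ_pair_liftPerm (σ : Equiv.Perm (Fin 7)) (G : Fin 8 → Fin 8 → ℤ) (hG : ∀ i j, G i j = G j i) :
    ∑ k : Fin 28, G (liftPerm σ (fstIdx k)) (liftPerm σ (sndIdx k)) = ∑ k : Fin 28, G (fstIdx k) (sndIdx k) := by
  rw [sum_univ_fin28_eq_sum_allPairs (fun i j => G (liftPerm σ i) (liftPerm σ j)),
    sum_univ_fin28_eq_sum_allPairs G]
  have h := sum_allPairs_comp_perm (M := ℤ) (liftPerm σ) G hG
  simp only [two_nsmul] at h
  linarith

/-! ### The saving read on an arbitrary floor vector -/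

/-- The torus term of `σ ∈ S₇` read on a floor vector `N ∈ ℤ²⁸`: `Σ_{i∈F} (N_i − N_{π_σ i})`, `π_σ i` the pair
`{σ̃ (fstIdx i), σ̃ (sndIdx i)}`. -/
def floorTerm (N : Fin 28 → ℤ) (σ : Equiv.Perm (Fin 7)) : ℤ :=
  ∑ i ∈ FIdx, (N i - pairVal N (liftPerm σ (fstIdx i)) (liftPerm σ (sndIdx i)))

/-- **The saving read on a floor vector**: `floorN N = max_{σ∈S₇} floorTerm N σ`. -/
def floorN (N : Fin 28 → ℤ) : ℤ :=
  (Finset.univ : Finset (Equiv.Perm (Fin 7))).sup' Finset.univ_nonempty (floorTerm N)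

/-- The torus term of `θ` is the floor term of its 28 floors. -/
theorem torusTerm_eq_floorTerm (θ : Fin 8 → ℝ) (σ : Equiv.Perm (Fin 7)) :
    torusTerm θ σ = floorTerm (fun k => ⌊phiForm θ k⌋) σ := by
  unfold torusTerm floorTerm
  refine Finset.sum_congr rfl fun i _ => ?_
  rw [phiForm_permS, pairVal_phiForm (fun x => ⌊x⌋) θ ((liftPerm σ).injective.ne (fstIdx_ne_sndIdx i))]

/-- **`𝒩(θ) = floorN (⌊φ_k θ⌋)_k`**: the torus saving is the floor functional evaluated at the 28 floors. -/
theorem torusN_eq_floorN (θ : Fin 8 → ℝ) : torusN θ = floorN fun k => ⌊phiForm θ k⌋ := by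
  unfold torusN floorN
  congr 1
  ext σ
  exact torusTerm_eq_floorTerm θ σ

/-- The identity of `S₇` contributes `0` on every floor vector. -/
theorem floorTerm_one (N : Fin 28 → ℤ) : floorTerm N 1 = 0 := by
  unfold floorTerm
  refine Finset.sum_eq_zero fun i _ => ?_
  have h1 : ∀ j : Fin 8, liftPerm 1 j = j := fun j => by
    refine Fin.cases ?_ (fun j' => ?_) j
    · rfl
    · rw [liftPerm_succ, Equiv.Perm.one_apply]
  rw [h1, h1, pairVal_fstIdx_sndIdx, sub_self]

/-- Every floor term is below the floor value. -/
theorem floorTerm_le_floorN (N : Fin 28 → ℤ) (σ : Equiv.Perm (Fin 7)) : floorTerm N σ ≤ floorN N :=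
  Finset.le_sup' (floorTerm N) (Finset.mem_univ σ)

/-- The floor value is attained by some `σ`. -/
theorem exists_floorTerm_eq_floorN (N : Fin 28 → ℤ) : ∃ σ, floorN N = floorTerm N σ := by
  obtain ⟨σ, -, h⟩ := Finset.exists_mem_eq_sup' Finset.univ_nonempty (floorTerm N)
  exact ⟨σ, h⟩

/-- `0 ≤ floorN N` for every floor vector. -/
theorem floorN_nonneg (N : Fin 28 → ℤ) : 0 ≤ floorN N := by
  rw [← floorTerm_one N]
  exact floorTerm_le_floorN N 1

/-! ### The canonical junction pattern function -/

open scoped Classical in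
/-- **THE CANONICAL JUNCTION PATTERN FUNCTION.** At height `b` along the orbit of `a` (point `θ_b = b·s(a)`), for a set
`A` of forms: the saving read on the floor vector in which every MEMBER form `k` (`b·h_k(a) ∈ ℤ`) has floor `b·h_k(a)`
if `k ∈ A` («up», form value in `[z, z+1)`) and `b·h_k(a) − 1` if `k ∉ A` («down», form value in `(z−1, z)`), and every
non-member floor is `⌊b·h_k(a)⌋` (frozen). On the realisable patterns this is the saving near `θ_b`
(`torusN_bkpt_add_eq_patternN`); on all others it is THE extension the cell's desk uses (P2 g11's Hamiltonian-path value with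
the member costs set to `0`/`1`) — here a definition, with no value at any named junction asserted. -/
def patternN (a : Dir) (b : ℝ) (A : Finset (Fin 28)) : ℤ :=
  floorN fun k => ⌊b * h28 a k⌋ - if (∃ z : ℤ, b * h28 a k = z) ∧ k ∉ A then 1 else 0

open scoped Classical in
/-- **The floors near a junction, as one formula.** At `b ∈ bkpts a T`, for a displacement `Δ` whose 28 forms are `< 1`
and `< wallDist a T` in size: `⌊φ_k(θ_b + Δ)⌋ = ⌊b·h_k(a)⌋ − [b·h_k(a) ∈ ℤ ∧ φ_k(Δ) < 0]` for EVERY form `k`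
(`floor_phiForm_bkpt_add`, the three cases merged; the member case `φ_k(Δ) = 0` included). -/
theorem floor_phiForm_bkpt_add_eq {a : Dir} {T b : ℝ} (hb : b ∈ bkpts a T) {Δ : Fin 8 → ℝ}
    (hΔ1 : ∀ k, |phiForm Δ k| < 1) (hΔ2 : ∀ k, |phiForm Δ k| < wallDist a T) (k : Fin 28) :
    ⌊phiForm (b • sParam a + Δ) k⌋ =
      ⌊b * h28 a k⌋ - if (∃ z : ℤ, b * h28 a k = z) ∧ ¬ 0 ≤ phiForm Δ k then 1 else 0 := by
  obtain ⟨-, hn, hnon⟩ := floor_phiForm_bkpt_add hb hΔ1 hΔ2 k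
  by_cases hm : ∃ z : ℤ, b * h28 a k = z
  · obtain ⟨z, hz⟩ := hm
    have hzf : ⌊b * h28 a k⌋ = z := by rw [hz, Int.floor_intCast]
    by_cases h0 : 0 ≤ phiForm Δ k
    · rw [if_neg (fun h => h.2 h0), sub_zero, hzf, phiForm_line, hz, Int.floor_intCast_add,
        Int.floor_eq_zero_iff.mpr ⟨h0, (abs_lt.mp (hΔ1 k)).2⟩, add_zero]
    · rw [if_pos ⟨⟨z, hz⟩, h0⟩, hzf]
      exact hn z hz (not_le.mp h0)
  · rw [if_neg (fun h => hm h.1), sub_zero]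
    push Not at hm
    exact hnon hm

open scoped Classical in
/-- **THE SAVING NEAR A JUNCTION IS THE CANONICAL PATTERN FUNCTION OF THE MEMBER-SIGN PATTERN** — the hypothesis `hf` of
the cusp chain DISCHARGED. At `b ∈ bkpts a T`, for every displacement `Δ` with all 28 forms `< 1` and `< wallDist a T` in
size and every finset `M` containing the members of `b`:
`𝒩(b·s(a) + Δ) = patternN a b {k ∈ M : 0 ≤ φ_k(Δ)}`. -/
theorem torusN_bkpt_add_eq_patternN {a : Dir} {T b : ℝ} (hb : b ∈ bkpts a T) {Δ : Fin 8 → ℝ}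
    (hΔ1 : ∀ k, |phiForm Δ k| < 1) (hΔ2 : ∀ k, |phiForm Δ k| < wallDist a T)
    {M : Finset (Fin 28)} (hM : ∀ k, (∃ z : ℤ, b * h28 a k = z) → k ∈ M) :
    torusN (b • sParam a + Δ) = patternN a b (M.filter fun k => 0 ≤ phiForm Δ k) := by
  rw [torusN_eq_floorN]
  unfold patternN
  congr 1
  funext k
  rw [floor_phiForm_bkpt_add_eq hb hΔ1 hΔ2 k]
  by_cases hm : ∃ z : ℤ, b * h28 a k = z
  · have hiff : (¬ 0 ≤ phiForm Δ k) ↔ k ∉ M.filter fun k => 0 ≤ phiForm Δ k := by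
      rw [Finset.mem_filter, not_and]
      exact ⟨fun h _ => h, fun h => h (hM k hm)⟩
    by_cases h0 : 0 ≤ phiForm Δ k
    · rw [if_neg (fun h => h.2 h0), if_neg (fun h => (hiff.mpr h.2) h0)]
    · rw [if_pos ⟨hm, h0⟩, if_pos ⟨hm, hiff.mp h0⟩]
  · rw [if_neg (fun h => hm h.1), if_neg (fun h => hm h.1)]

open scoped Classical in
/-- The same in the shape of the chain's hypothesis `hf` (real-valued pattern function). -/
theorem torusN_bkpt_add_eq_patternN_real {a : Dir} {T b : ℝ} (hb : b ∈ bkpts a T)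
    {M : Finset (Fin 28)} (hM : ∀ k, (∃ z : ℤ, b * h28 a k = z) → k ∈ M) (Δ : Fin 8 → ℝ)
    (hΔ1 : ∀ k, |phiForm Δ k| < 1) (hΔ2 : ∀ k, |phiForm Δ k| < wallDist a T) :
    (torusN (b • sParam a + Δ) : ℝ) = ((patternN a b (M.filter fun k => 0 ≤ phiForm Δ k) : ℤ) : ℝ) := by
  rw [torusN_bkpt_add_eq_patternN hb hΔ1 hΔ2 hM]

open scoped Classical in
/-- **Only the member part of the pattern matters**: if `A` and `A'` contain the same members of `b`, then
`patternN a b A = patternN a b A'`. -/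
theorem patternN_congr {a : Dir} {b : ℝ} {A A' : Finset (Fin 28)}
    (h : ∀ k, (∃ z : ℤ, b * h28 a k = z) → (k ∈ A ↔ k ∈ A')) : patternN a b A = patternN a b A' := by
  unfold patternN
  congr 1
  funext k
  by_cases hm : ∃ z : ℤ, b * h28 a k = z
  · by_cases hk : k ∈ A
    · rw [if_neg (fun h' => h'.2 hk), if_neg (fun h' => h'.2 ((h k hm).mp hk))]
    · rw [if_pos ⟨hm, hk⟩, if_pos ⟨hm, fun h' => hk ((h k hm).mpr h')⟩]
  · rw [if_neg (fun h' => hm h'.1), if_neg (fun h' => hm h'.1)]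

open scoped Classical in
/-- In particular `patternN a b (A ∩ M) = patternN a b A` for every finset `M` containing the members of `b` (the shape
`f m (A ∩ M m)` of the chain's period pattern function `hF`). -/
theorem patternN_inter_eq {a : Dir} {b : ℝ} {M : Finset (Fin 28)} (hM : ∀ k, (∃ z : ℤ, b * h28 a k = z) → k ∈ M)
    (A : Finset (Fin 28)) : patternN a b (A ∩ M) = patternN a b A :=
  patternN_congr fun k hk => by rw [Finset.mem_inter]; exact ⟨fun h => h.1, fun h => ⟨h, hM k hk⟩⟩

end Summit.KontsevichZagierPeriods.Zeta5Search.Barrier.ConeGamma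

end
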